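import Summits.QuantumFields.BalabanUV.T4Continuum.Support.NE7HessGaugeDir
import Summits.QuantumFields.BalabanUV.T4Continuum.Support.NE7HessGaugeDirLeftGeneral
import HarnessLib

/-!
# NE7HessGaugePairingBound — THE WILSON HESSIAN PAIRS ANY DIRECTION WITH A PURE GAUGE ONLY TENSION-WEAKLY: under the tension letter `|dAction V K| ≤ τ‖K‖₁` (skew
# `P`-periodic `K`), for skew `P`-periodic `Y` and a skew `P`-periodic gauge function `ξ`,
# `|hess V Y (D_Vξ)| ≤ 2τ·Σ_{x,κ}‖ξ x‖‖Y x κ‖` and `|hess V (D_Vξ) Y| ≤ 2τ·Σ_{x,κ}‖ξ(x+e_κ)‖‖Y x κ‖` (hence the symmetric Hessian by the mean) — the hypothesis `hten` of the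
# abstract transfer F207 (`NE7CoercivityGaugeTransfer`) in the tree's vocabulary, from the exact identities `NE7HessGaugeDir.hess_gaugeDir_eq` and
# `NE7HessGaugeDirLeftGeneral.hess_gaugeDir_left` (file 137 of the curved (APE), F208)

Cell `pub-balaban`, rung (B)+1 sub-cell t4, lineage `b2b-balaban-t4-ne7-p1` (CRUX PROVER NE7 #1 = OWNER of row NE7), generation 85; memo
`t4/b2b-balaban-t4-ne7-p1-g85/LAGRANGE-CARRIER.md` §10.  Over `NE7HessGaugeDir.hess_gaugeDir_eq` (`hess V X (D_Vζ) = −dAction V [Ad_{V⁻¹}ζ, X]`),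
`NE7HessGaugeDirLeftGeneral.hess_gaugeDir_left` (`hess V (D_Vξ) Y = dAction V [Y, ξ(·+e_κ)]`), `AveragingDeficitTransport.norm_Ad_of_unitary`∕`Ad_mem_skewAdjoint`,
`NE3ProductPath.commutator_mem_skewAdjoint` BY NAME.
WHY.  Memo §10's transfer of row NE3's tangent coercivity from its slice to the [B8] (1.38) slice, and the cross terms `hess(t, D_Wμ)`, `hess(r, D_Wμ)` of the positivity proof, need
exactly «the Hessian against a pure gauge is a first variation of a commutator, hence tension-small»; the identities are in the tree, THIS file is their one-line size consequence.
WHAT ([folklore]; 0 def, 0 sorry).  §1 `dirL1_comm_left_le`, `dirL1_comm_shift_le` (the `ℓ¹` size of the two commutator fields: `≤ 2Σ‖ξ‖‖Y‖`); §2 **`abs_hess_gaugeDir_right_le`**,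
**`abs_hess_gaugeDir_left_le`**, `abs_hessSym_gaugeDir_le` (the symmetric Hessian: the mean of the two).
HONEST FRAMING (page 1): triangle inequalities on exact identities; the tension letter is a DISPLAYED HYPOTHESIS (a class theorem by `NE7TensionRadiusOfFluxGradient`); (P_a) NOT proved;
(KL-B) at curved `W` NOT proved; (APE) on curved data NOT proved; NOT ONE-STEP, NOT NE7; spine 0∕9; finite T⁴ rung (B)+1 — NOT infinite volume, NOT mass gap, NOT `BetaPertH`, NOT Clay.
Continuum YM on T⁴ ⇐ BetaPertH ∧ nine spine estimates (0/9 proved); BetaPertH ⇐ (D1) ∧ (D4) ∧ CAP+tail; G-an2-4 gates asym, D1 and NE2/3/4.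
-/

set_option autoImplicit false

open scoped BigOperators Matrix.Norms.L2Operator
open Finset

namespace Summit.QuantumFields.BalabanUV.T4Continuum.NE7HessGaugePairingBound

open Literature.MathematicalPhysics.QuantumFieldTheory.Balaban1983to89
open B7Prop1Explicit B7Prop2Explicit UnitaryModel
open T4AveragingDeficitWall (Ad IsUnitaryCfg IsSkewDir dirL1)
open T4AveragingDeficitWallBoundary (IsPeriodicCfg)
open AveragingDeficitPeriodicCounting (IsPeriodicDir)
open AveragingDeficitTransport (norm_Ad_of_unitary Ad_mem_skewAdjoint)
open BlockAveragePushDirGauge (gaugeDir)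
open NE3HessForm (hess dAction)
open NE3EnergyHessBilin (hessSym hessSym_apply)
open NE3ProductPath (commutator_mem_skewAdjoint)
open NE7HessGaugeDir (hess_gaugeDir_eq)
open NE7HessGaugeDirLeftGeneral (hess_gaugeDir_left)

noncomputable section

variable {d : ℕ} {n : Type*} [Fintype n] [DecidableEq n]

/-! ## §1 The `ℓ¹` size of the commutator fields -/

/-- **`‖[Ad_{V⁻¹}ξ, Y]‖_{ℓ¹(B)} ≤ 2·Σ_{x∈B} Σ_κ ‖ξ x‖·‖Y x κ‖`** (unitary `V`). [folklore] -/
theorem dirL1_comm_left_le {V : Site d → Fin d → (Matrix n n ℂ)ˣ} (hV : IsUnitaryCfg V) (ξ : Site d → Matrix n n ℂ) (Y : Site d → Fin d → Matrix n n ℂ) (B : Finset (Site d)) :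
    dirL1 (fun x κ => Ad (V x κ)⁻¹ (ξ x) * Y x κ - Y x κ * Ad (V x κ)⁻¹ (ξ x)) B ≤ 2 * ∑ x ∈ B, ∑ κ : Fin d, ‖ξ x‖ * ‖Y x κ‖ := by
  unfold dirL1
  rw [Finset.mul_sum]
  refine Finset.sum_le_sum fun x _ => ?_
  rw [Finset.mul_sum]
  refine Finset.sum_le_sum fun κ _ => ?_
  have hA : ‖Ad (V x κ)⁻¹ (ξ x)‖ = ‖ξ x‖ := norm_Ad_of_unitary ((unitaryUnits (Matrix n n ℂ)).inv_mem (hV x κ)) _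
  calc ‖Ad (V x κ)⁻¹ (ξ x) * Y x κ - Y x κ * Ad (V x κ)⁻¹ (ξ x)‖
      ≤ ‖Ad (V x κ)⁻¹ (ξ x) * Y x κ‖ + ‖Y x κ * Ad (V x κ)⁻¹ (ξ x)‖ := norm_sub_le _ _
    _ ≤ ‖Ad (V x κ)⁻¹ (ξ x)‖ * ‖Y x κ‖ + ‖Y x κ‖ * ‖Ad (V x κ)⁻¹ (ξ x)‖ := add_le_add (norm_mul_le _ _) (norm_mul_le _ _)
    _ = 2 * (‖ξ x‖ * ‖Y x κ‖) := by rw [hA]; ring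

/-- **`‖[Y, ξ(·+e_κ)]‖_{ℓ¹(B)} ≤ 2·Σ_{x∈B} Σ_κ ‖ξ(x+e_κ)‖·‖Y x κ‖`**. [folklore] -/
theorem dirL1_comm_shift_le (ξ : Site d → Matrix n n ℂ) (Y : Site d → Fin d → Matrix n n ℂ) (B : Finset (Site d)) :
    dirL1 (fun x κ => Y x κ * ξ (x + e κ) - ξ (x + e κ) * Y x κ) B ≤ 2 * ∑ x ∈ B, ∑ κ : Fin d, ‖ξ (x + e κ)‖ * ‖Y x κ‖ := by
  unfold dirL1
  rw [Finset.mul_sum]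
  refine Finset.sum_le_sum fun x _ => ?_
  rw [Finset.mul_sum]
  refine Finset.sum_le_sum fun κ _ => ?_
  calc ‖Y x κ * ξ (x + e κ) - ξ (x + e κ) * Y x κ‖
      ≤ ‖Y x κ * ξ (x + e κ)‖ + ‖ξ (x + e κ) * Y x κ‖ := norm_sub_le _ _
    _ ≤ ‖Y x κ‖ * ‖ξ (x + e κ)‖ + ‖ξ (x + e κ)‖ * ‖Y x κ‖ := add_le_add (norm_mul_le _ _) (norm_mul_le _ _)
    _ = 2 * (‖ξ (x + e κ)‖ * ‖Y x κ‖) := by ring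

/-! ## §2 The Hessian against a pure gauge, under the tension letter -/

/-- **RIGHT SLOT**: `|hess V Y (D_Vξ) F| ≤ 2τ·Σ_{x∈B}Σ_κ ‖ξ x‖‖Y x κ‖` for skew `P`-periodic `Y`, `ξ` and unitary `P`-periodic `V`, under the tension letter on skew `P`-periodic fields
with `ℓ¹(B)`. [folklore] -/
theorem abs_hess_gaugeDir_right_le {V : Site d → Fin d → (Matrix n n ℂ)ˣ} (hV : IsUnitaryCfg V) {P : ℕ} (hVP : IsPeriodicCfg V (P : ℤ))
    (F : Finset (T4AveragingDeficitWall.Plaq d)) (B : Finset (Site d)) {τ : ℝ} (hτ : 0 ≤ τ)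
    (hten : ∀ K : Site d → Fin d → Matrix n n ℂ, IsSkewDir K → IsPeriodicDir K (P : ℤ) → |dAction V K F| ≤ τ * dirL1 K B)
    {Y : Site d → Fin d → Matrix n n ℂ} (hYs : IsSkewDir Y) (hYP : IsPeriodicDir Y (P : ℤ))
    {ξ : Site d → Matrix n n ℂ} (hξs : ∀ x, ξ x ∈ skewAdjoint (Matrix n n ℂ)) (hξP : ∀ (x : Site d) (i : Fin d), ξ (x + (P : ℤ) • e i) = ξ x) :
    |hess V Y (gaugeDir V ξ) F| ≤ 2 * τ * ∑ x ∈ B, ∑ κ : Fin d, ‖ξ x‖ * ‖Y x κ‖ := by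
  rw [hess_gaugeDir_eq, abs_neg]
  have hKs : IsSkewDir (fun x κ => Ad (V x κ)⁻¹ (ξ x) * Y x κ - Y x κ * Ad (V x κ)⁻¹ (ξ x)) := fun x κ =>
    commutator_mem_skewAdjoint (Ad_mem_skewAdjoint ((unitaryUnits (Matrix n n ℂ)).inv_mem (hV x κ)) (hξs x)) (hYs x κ)
  have hKP : IsPeriodicDir (fun x κ => Ad (V x κ)⁻¹ (ξ x) * Y x κ - Y x κ * Ad (V x κ)⁻¹ (ξ x)) (P : ℤ) := by
    intro x i κ
    show Ad (V (x + (P : ℤ) • e i) κ)⁻¹ (ξ (x + (P : ℤ) • e i)) * Y (x + (P : ℤ) • e i) κ - Y (x + (P : ℤ) • e i) κ * Ad (V (x + (P : ℤ) • e i) κ)⁻¹ (ξ (x + (P : ℤ) • e i))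
      = Ad (V x κ)⁻¹ (ξ x) * Y x κ - Y x κ * Ad (V x κ)⁻¹ (ξ x)
    rw [hVP, hξP, hYP]
  calc |dAction V (fun x κ => Ad (V x κ)⁻¹ (ξ x) * Y x κ - Y x κ * Ad (V x κ)⁻¹ (ξ x)) F|
      ≤ τ * dirL1 (fun x κ => Ad (V x κ)⁻¹ (ξ x) * Y x κ - Y x κ * Ad (V x κ)⁻¹ (ξ x)) B := hten _ hKs hKP
    _ ≤ τ * (2 * ∑ x ∈ B, ∑ κ : Fin d, ‖ξ x‖ * ‖Y x κ‖) := mul_le_mul_of_nonneg_left (dirL1_comm_left_le hV ξ Y B) hτ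
    _ = 2 * τ * ∑ x ∈ B, ∑ κ : Fin d, ‖ξ x‖ * ‖Y x κ‖ := by ring

/-- **LEFT SLOT**: `|hess V (D_Vξ) Y F| ≤ 2τ·Σ_{x∈B}Σ_κ ‖ξ(x+e_κ)‖‖Y x κ‖` (`P ≥ 2`). [folklore] -/
theorem abs_hess_gaugeDir_left_le (V : Site d → Fin d → (Matrix n n ℂ)ˣ) {P : ℕ} (hP : 2 ≤ P)
    (F : Finset (T4AveragingDeficitWall.Plaq d)) (B : Finset (Site d)) {τ : ℝ} (hτ : 0 ≤ τ)
    (hten : ∀ K : Site d → Fin d → Matrix n n ℂ, IsSkewDir K → IsPeriodicDir K (P : ℤ) → |dAction V K F| ≤ τ * dirL1 K B)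
    {Y : Site d → Fin d → Matrix n n ℂ} (hYs : IsSkewDir Y) (hYP : IsPeriodicDir Y (P : ℤ))
    {ξ : Site d → Matrix n n ℂ} (hξs : ∀ x, ξ x ∈ skewAdjoint (Matrix n n ℂ)) (hξP : ∀ (x : Site d) (i : Fin d), ξ (x + (P : ℤ) • e i) = ξ x) :
    |hess V (gaugeDir V ξ) Y F| ≤ 2 * τ * ∑ x ∈ B, ∑ κ : Fin d, ‖ξ (x + e κ)‖ * ‖Y x κ‖ := by
  rw [hess_gaugeDir_left hP V hξP Y F]
  have hKs : IsSkewDir (fun x κ => Y x κ * ξ (x + e κ) - ξ (x + e κ) * Y x κ) := fun x κ => commutator_mem_skewAdjoint (hYs x κ) (hξs _)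
  have hKP : IsPeriodicDir (fun x κ => Y x κ * ξ (x + e κ) - ξ (x + e κ) * Y x κ) (P : ℤ) := by
    intro x i κ
    show Y (x + (P : ℤ) • e i) κ * ξ (x + (P : ℤ) • e i + e κ) - ξ (x + (P : ℤ) • e i + e κ) * Y (x + (P : ℤ) • e i) κ = Y x κ * ξ (x + e κ) - ξ (x + e κ) * Y x κ
    rw [hYP, add_right_comm, hξP]
  calc |dAction V (fun x κ => Y x κ * ξ (x + e κ) - ξ (x + e κ) * Y x κ) F|
      ≤ τ * dirL1 (fun x κ => Y x κ * ξ (x + e κ) - ξ (x + e κ) * Y x κ) B := hten _ hKs hKP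
    _ ≤ τ * (2 * ∑ x ∈ B, ∑ κ : Fin d, ‖ξ (x + e κ)‖ * ‖Y x κ‖) := mul_le_mul_of_nonneg_left (dirL1_comm_shift_le ξ Y B) hτ
    _ = 2 * τ * ∑ x ∈ B, ∑ κ : Fin d, ‖ξ (x + e κ)‖ * ‖Y x κ‖ := by ring

/-- **THE SYMMETRIC HESSIAN AGAINST A PURE GAUGE**: `|hessSym V F Y (D_Vξ)| ≤ τ·Σ_{x,κ}(‖ξ x‖ + ‖ξ(x+e_κ)‖)·‖Y x κ‖`. [folklore] -/
theorem abs_hessSym_gaugeDir_le {V : Site d → Fin d → (Matrix n n ℂ)ˣ} (hV : IsUnitaryCfg V) {P : ℕ} (hP : 2 ≤ P) (hVP : IsPeriodicCfg V (P : ℤ))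
    (F : Finset (T4AveragingDeficitWall.Plaq d)) (B : Finset (Site d)) {τ : ℝ} (hτ : 0 ≤ τ)
    (hten : ∀ K : Site d → Fin d → Matrix n n ℂ, IsSkewDir K → IsPeriodicDir K (P : ℤ) → |dAction V K F| ≤ τ * dirL1 K B)
    {Y : Site d → Fin d → Matrix n n ℂ} (hYs : IsSkewDir Y) (hYP : IsPeriodicDir Y (P : ℤ))
    {ξ : Site d → Matrix n n ℂ} (hξs : ∀ x, ξ x ∈ skewAdjoint (Matrix n n ℂ)) (hξP : ∀ (x : Site d) (i : Fin d), ξ (x + (P : ℤ) • e i) = ξ x) :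
    |hessSym V F Y (gaugeDir V ξ)| ≤ τ * ∑ x ∈ B, ∑ κ : Fin d, (‖ξ x‖ + ‖ξ (x + e κ)‖) * ‖Y x κ‖ := by
  rw [hessSym_apply]
  have h1 := abs_hess_gaugeDir_right_le hV hVP F B hτ hten hYs hYP hξs hξP
  have h2 := abs_hess_gaugeDir_left_le V hP F B hτ hten hYs hYP hξs hξP
  have hsum : ∑ x ∈ B, ∑ κ : Fin d, (‖ξ x‖ + ‖ξ (x + e κ)‖) * ‖Y x κ‖
      = (∑ x ∈ B, ∑ κ : Fin d, ‖ξ x‖ * ‖Y x κ‖) + ∑ x ∈ B, ∑ κ : Fin d, ‖ξ (x + e κ)‖ * ‖Y x κ‖ := by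
    rw [← Finset.sum_add_distrib]
    refine Finset.sum_congr rfl fun x _ => ?_
    rw [← Finset.sum_add_distrib]
    refine Finset.sum_congr rfl fun κ _ => ?_
    ring
  rw [hsum, abs_div, abs_two]
  have h3 := abs_add_le (hess V Y (gaugeDir V ξ) F) (hess V (gaugeDir V ξ) Y F)
  linarith

end

end Summit.QuantumFields.BalabanUV.T4Continuum.NE7HessGaugePairingBound
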